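import Summits.CriticalPhenomena.CardyFormulaZ2.Theorems.CardyFlipRussoVoronoiHubFromSmirnovGraphDefs
import Literature.Probability.Percolation.VoronoiArmEstimates

/-!
# One-arm route to graph transport — third definitions module of line
# `moebius-exact-delaunay-dilation-ward` (crux `VoronoiHubFromSmirnov`, stmt-CriticalPhenomena-6433)

Lead c3 (2026-08-17) re-plans the remaining probabilistic stub S3b-i `Sig.stub_graphTransport`
(Benjamini–Schramm 1998, Thm 2.1 in graph form: for the SAME nuclei, Euclidean and pulled-back
Delaunay chains cross with probabilities differing by `o(1)`).  Benjamini–Schramm's own route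
(§§6–9: exponential tile moments, clean configurations, insensitivity) avoids RSW at the price of a
long apparatus.  In the plane and at `p = 1/2` a shorter route is available once Tassion's one-arm
decay is granted — and the tree already NAMES that fact,
`Literature.Probability.Percolation.VoronoiAnnealedOneArm` (Tassion 2016, Thm 3 (2), annealed and
mesh-uniform, for two independent Poisson processes of Lebesgue intensity = the line's homogeneous
law `lawBW volume`).  The route ("defect telescoping in the image domain"):

1. transport to the IMAGE side, where the nuclei `σ = T(τ ∩ V/δ)` are a HOMOGENEOUS Poisson pair
   (`ρ = ‖h′‖²` on `V`; landed `map_transport_poissonLaw`, `stub_graphLaw`): the two events become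
   chain events of `σ` for two adjacency relations on the same points — Euclidean Delaunay adjacency
   `E₁` and the adjacency `E₂` pulled back through `g = h⁻¹` (`adjPull`);
2. switch the adjacency from `E₁` to `E₂` square by square (side `ℓ ≍ √log δ⁻¹`, `adjHyb`): one
   telescoping step changes the chain event only if the square carries a DEFECT PAIR (`DefSq`:
   `E₁ ≠ E₂`, hence a potential defect, probability `O(δ² polylog δ⁻¹)` by the landed
   `defect_implies_potentialDefect`, `poisson_navelTie_le`, `poisson_closePair_le`) AND whitening the
   square destroys the crossing, which on the no-void event (`NoVoid`) forces a black Delaunay chain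
   across the annulus between radii `100 ℓ` and `δ^{-1/2}` around the square (`ChainArm`) — except
   through at most one other defective cluster, splitting the annulus in two;
3. defect events and arm events live on disjoint regions, so their probabilities MULTIPLY
   (independence of disjoint restrictions, `IsPoissonPointProcess.iIndepFun_restrict`), and a black
   Delaunay chain across an annulus is a black path of cells, whose probability Tassion's bound
   controls: the sum over the `O(δ⁻² ℓ⁻²)` squares is `polylog(δ⁻¹) · (ℓ² δ)^{η/2} → 0`.

This module only NAMES the objects of steps 1–3 and the conditional core
`Sig.stub_graphTransportCore : VoronoiAnnealedOneArm → Sig.stub_graphTransport`; the skeleton's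
S3b-i becomes `stub_graphTransportCore stub_voronoiOneArm`, the second factor being the named
Literature fact itself (a registered debt, like the Ward bound S2′).

Sources: I. Benjamini, O. Schramm, Comm. Math. Phys. 197 (1998) §4 (defects and potential defects),
§9 (9.1) (pivotality of the defect zone); V. Tassion, Ann. Probab. 44 (2016) Thm 3 (2) (one-arm
decay); B. Bollobás, O. Riordan, *Percolation* (2006) Ch. 8 §8.2 (Delaunay-chain formulation).
-/

noncomputable section

namespace Summit.CriticalPhenomena.CardyFormulaZ2.Cruxes.VoronoiHubFromSmirnov.MoebiusExactDelaunayDilationWard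

open scoped Topology
open Filter Set MeasureTheory
open Literature.Analysis.FunctionSpaces
open Literature.Probability.RandomPlanarGeometry
open Literature.Probability.LatticeModels (IsDelaunayPair)

/-! ### Chains for an arbitrary adjacency relation -/

/-- **Chain crossing for an adjacency relation `E`** (the common shape of `graphCross` and
`hGraphCross`): a chain `p₀, …, p_N` of points of `b` (the black nuclei), physically inside `K`
(`δ pᵢ ∈ K`), attached by `δ p₀ ∈ A₀`, `δ p_N ∈ A₂`, consecutive points `E`-adjacent. -/
def adjCross (E : ℂ → ℂ → Prop) (K A₀ A₂ : Set ℂ) (δ : ℝ) (b : Set ℂ) : Prop :=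
  ∃ (N : ℕ) (p : Fin (N + 1) → ℂ), (∀ i, p i ∈ b) ∧ (∀ i, (δ : ℂ) * p i ∈ K) ∧
    (δ : ℂ) * p 0 ∈ A₀ ∧ (δ : ℂ) * p (Fin.last N) ∈ A₂ ∧ ∀ i : Fin N, E (p i.castSucc) (p i.succ)

/-- `graphCross` is the chain crossing for Euclidean Delaunay adjacency of all nuclei. -/
theorem mem_graphCross_iff_adjCross (K A₀ A₂ : Set ℂ) (δ : ℝ) (c : PointConfig ℂ × PointConfig ℂ) :
    c ∈ graphCross K A₀ A₂ δ ↔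
      adjCross (IsDelaunayPair ((c.1 : Set ℂ) ∪ (c.2 : Set ℂ))) K A₀ A₂ δ (c.1 : Set ℂ) :=
  Iff.rfl

/-- `hGraphCross` is the chain crossing for the pulled-back adjacency. -/
theorem mem_hGraphCross_iff_adjCross (K A₀ A₂ : Set ℂ) (h : ℂ → ℂ) (V : Set ℂ) (δ : ℝ)
    (c : PointConfig ℂ × PointConfig ℂ) :
    c ∈ hGraphCross K A₀ A₂ h V δ ↔
      adjCross (fun p q => IsDelaunayPair (transportSet h V δ c.1 ∪ transportSet h V δ c.2)
        (transportMap h δ p) (transportMap h δ q)) K A₀ A₂ δ (c.1 : Set ℂ) :=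
  Iff.rfl

/-- Chain crossings are monotone in the adjacency relation. -/
theorem adjCross_mono {E E' : ℂ → ℂ → Prop} (hEE' : ∀ p q, E p q → E' p q) {K A₀ A₂ : Set ℂ}
    {δ : ℝ} {b : Set ℂ} (h : adjCross E K A₀ A₂ δ b) : adjCross E' K A₀ A₂ δ b := by
  obtain ⟨N, p, hb, hK, h0, hN, hE⟩ := h
  exact ⟨N, p, hb, hK, h0, hN, fun i => hEE' _ _ (hE i)⟩

/-- Chain crossings are monotone in the set of black nuclei (black-increasing). -/
theorem adjCross_mono_set {E : ℂ → ℂ → Prop} {K A₀ A₂ : Set ℂ} {δ : ℝ} {b b' : Set ℂ}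
    (hbb' : b ⊆ b') (h : adjCross E K A₀ A₂ δ b) : adjCross E K A₀ A₂ δ b' := by
  obtain ⟨N, p, hb, hK, h0, hN, hE⟩ := h
  exact ⟨N, p, fun i => hbb' (hb i), hK, h0, hN, hE⟩

/-! ### The two adjacency relations of the image side, squares, hybrids -/

/-- **Euclidean adjacency read in a window `W`** (configuration coordinates): Delaunay adjacency with
respect to the nuclei of both colours lying in `W`. For `W = univ` this is the adjacency of
`graphCross`. -/
def adjEuc (W : Set ℂ) (c : PointConfig ℂ × PointConfig ℂ) (p q : ℂ) : Prop :=
  IsDelaunayPair (((c.1 : Set ℂ) ∩ W) ∪ ((c.2 : Set ℂ) ∩ W)) p q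

/-- **Pulled-back adjacency** through a map `g` on the physical window `V` at mesh `δ`: Delaunay
adjacency of the transported images (the adjacency of `hGraphCross … g V δ`). -/
def adjPull (g : ℂ → ℂ) (V : Set ℂ) (δ : ℝ) (c : PointConfig ℂ × PointConfig ℂ) (p q : ℂ) : Prop :=
  IsDelaunayPair (transportSet g V δ c.1 ∪ transportSet g V δ c.2)
    (transportMap g δ p) (transportMap g δ q)

/-- With `adjEuc univ` the chain crossing is `graphCross`. -/
theorem mem_graphCross_iff_adjCross_adjEuc (K A₀ A₂ : Set ℂ) (δ : ℝ)
    (c : PointConfig ℂ × PointConfig ℂ) :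
    c ∈ graphCross K A₀ A₂ δ ↔ adjCross (adjEuc univ c) K A₀ A₂ δ (c.1 : Set ℂ) := by
  have h : adjEuc univ c = IsDelaunayPair ((c.1 : Set ℂ) ∪ (c.2 : Set ℂ)) := by
    funext p q
    simp only [adjEuc, inter_univ]
  rw [h]
  rfl

/-- With `adjPull g V δ` the chain crossing is `hGraphCross … g V δ`. -/
theorem mem_hGraphCross_iff_adjCross_adjPull (K A₀ A₂ : Set ℂ) (g : ℂ → ℂ) (V : Set ℂ) (δ : ℝ)
    (c : PointConfig ℂ × PointConfig ℂ) :
    c ∈ hGraphCross K A₀ A₂ g V δ ↔ adjCross (adjPull g V δ c) K A₀ A₂ δ (c.1 : Set ℂ) :=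
  Iff.rfl

/-- **Square index** at side `ℓ`: the square `ℓ • (i + [0,1)²)` of the grid `ℓ ℤ²` containing `p`. -/
def sqIdx (ℓ : ℝ) (p : ℂ) : ℤ × ℤ :=
  (⌊p.re / ℓ⌋, ⌊p.im / ℓ⌋)

/-- The centre of the square of index `i` at side `ℓ`. -/
def sqCentre (ℓ : ℝ) (i : ℤ × ℤ) : ℂ :=
  ⟨((i.1 : ℝ) + 1 / 2) * ℓ, ((i.2 : ℝ) + 1 / 2) * ℓ⟩

/-- **Hybrid adjacency**: `E₂` on pairs with an endpoint in a switched square (index in `S`), `E₁`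
on all other pairs.  `S = ∅` gives `E₁`; once every square met by the chains is switched it is
`E₂` on all relevant pairs. -/
def adjHyb (S : Set (ℤ × ℤ)) (ℓ : ℝ) (E₁ E₂ : ℂ → ℂ → Prop) (p q : ℂ) : Prop :=
  ((sqIdx ℓ p ∈ S ∨ sqIdx ℓ q ∈ S) → E₂ p q) ∧ (¬ (sqIdx ℓ p ∈ S ∨ sqIdx ℓ q ∈ S) → E₁ p q)

/-- No square switched: the hybrid adjacency is `E₁`. -/
theorem adjHyb_empty (ℓ : ℝ) (E₁ E₂ : ℂ → ℂ → Prop) (p q : ℂ) :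
    adjHyb ∅ ℓ E₁ E₂ p q ↔ E₁ p q := by
  simp [adjHyb]

/-- Both endpoints in switched squares… indeed one suffices: the hybrid adjacency is `E₂`. -/
theorem adjHyb_of_mem {S : Set (ℤ × ℤ)} {ℓ : ℝ} (E₁ E₂ : ℂ → ℂ → Prop) {p q : ℂ}
    (h : sqIdx ℓ p ∈ S ∨ sqIdx ℓ q ∈ S) : adjHyb S ℓ E₁ E₂ p q ↔ E₂ p q := by
  simp only [adjHyb]
  exact ⟨fun h' => h'.1 h, fun h' => ⟨fun _ => h', fun hn => absurd h hn⟩⟩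

/-- No endpoint in a switched square: the hybrid adjacency is `E₁`. -/
theorem adjHyb_of_not_mem {S : Set (ℤ × ℤ)} {ℓ : ℝ} (E₁ E₂ : ℂ → ℂ → Prop) {p q : ℂ}
    (h : ¬ (sqIdx ℓ p ∈ S ∨ sqIdx ℓ q ∈ S)) : adjHyb S ℓ E₁ E₂ p q ↔ E₁ p q := by
  simp only [adjHyb]
  exact ⟨fun h' => h'.2 h, fun h' => ⟨fun hm => absurd hm h, fun _ => h'⟩⟩

/-- Switching one more square changes the hybrid adjacency only on pairs with an endpoint in it. -/
theorem adjHyb_insert_iff_of_ne {S : Set (ℤ × ℤ)} {ℓ : ℝ} (E₁ E₂ : ℂ → ℂ → Prop) {i : ℤ × ℤ}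
    {p q : ℂ} (hp : sqIdx ℓ p ≠ i) (hq : sqIdx ℓ q ≠ i) :
    adjHyb (insert i S) ℓ E₁ E₂ p q ↔ adjHyb S ℓ E₁ E₂ p q := by
  have h : (sqIdx ℓ p ∈ insert i S ∨ sqIdx ℓ q ∈ insert i S) ↔ (sqIdx ℓ p ∈ S ∨ sqIdx ℓ q ∈ S) := by
    simp only [mem_insert_iff, hp, hq, false_or]
  simp only [adjHyb, h]

/-! ### Defective squares, chain arms, voids -/

/-- **Defect pair carried by the square `i`** (side `ℓ`): two black nuclei of `b`, physically in `K`,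
one of them in the square, on which the two adjacency relations DISAGREE (Benjamini–Schramm's
defects, read square by square). -/
def DefSq (E₁ E₂ : ℂ → ℂ → Prop) (ℓ : ℝ) (i : ℤ × ℤ) (K : Set ℂ) (δ : ℝ) (b : Set ℂ) : Prop :=
  ∃ p q : ℂ, p ∈ b ∧ q ∈ b ∧ (δ : ℂ) * p ∈ K ∧ (δ : ℂ) * q ∈ K ∧
    (sqIdx ℓ p = i ∨ sqIdx ℓ q = i) ∧ ¬ (E₁ p q ↔ E₂ p q)

/-- **Chain arm** around `z` between radii `r₁ < r₂` for the adjacency `E`: an `E`-chain of points of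
`b`, physically in `K`, from the closed disc `B̄(z, r₁)` to the complement of the open disc
`B(z, r₂)` (configuration coordinates) — the graph form of a black arm across the annulus. -/
def ChainArm (E : ℂ → ℂ → Prop) (z : ℂ) (r₁ r₂ : ℝ) (K : Set ℂ) (δ : ℝ) (b : Set ℂ) : Prop :=
  ∃ (N : ℕ) (p : Fin (N + 1) → ℂ), (∀ i, p i ∈ b) ∧ (∀ i, (δ : ℂ) * p i ∈ K) ∧
    dist (p 0) z ≤ r₁ ∧ r₂ ≤ dist (p (Fin.last N)) z ∧ ∀ i : Fin N, E (p i.castSucc) (p i.succ)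

/-- **No void of radius `r` over the region `D`** (configuration coordinates): every point of `D` has
a nucleus of `t` at distance `< r`.  The complement is the event of the landed
`poisson_noVoid_tendsto` (`∃ z ∈ D, ∀ q ∈ t, r ≤ dist q z`). On it, Voronoi cells and empty
circumdiscs of nuclei near `D` have diameter `O(r)`. -/
def NoVoid (D : Set ℂ) (r : ℝ) (t : Set ℂ) : Prop :=
  ∀ z ∈ D, ∃ x ∈ t, dist x z < r

/-- Unfolding the complement of `NoVoid` into the event of `poisson_noVoid_tendsto`. -/
theorem not_noVoid_iff (D : Set ℂ) (r : ℝ) (t : Set ℂ) :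
    ¬ NoVoid D r t ↔ ∃ z ∈ D, ∀ x ∈ t, r ≤ dist x z := by
  simp only [NoVoid, not_forall, not_exists, not_and, not_lt, exists_prop]

/-- `NoVoid` is monotone: fewer test points, a larger radius, more nuclei. -/
theorem NoVoid.mono {D D' : Set ℂ} {r r' : ℝ} {t t' : Set ℂ} (h : NoVoid D r t) (hD : D' ⊆ D)
    (hr : r ≤ r') (ht : t ⊆ t') : NoVoid D' r' t' := fun z hz => by
  obtain ⟨x, hx, hxz⟩ := h z (hD hz)
  exact ⟨x, ht hx, hxz.trans_le hr⟩

/-- The mesoscopic scale of the route: `ℓ_C(δ) = C √|log δ|` (configuration coordinates), the radius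
below which voids are absent with probability `1 - o(1)` for `C` large (`poisson_noVoid_tendsto`). -/
def voidScale (C δ : ℝ) : ℝ :=
  C * Real.sqrt |Real.log δ|

/-! ### The conditional core of S3b-i -/

/-- S3b-i CORE — GRAPH TRANSPORT FROM TASSION'S ONE-ARM DECAY: the registered S3b-i statement
`Sig.stub_graphTransport` (Benjamini–Schramm 1998 Thm 2.1 in graph form) GIVEN the named Literature
fact `VoronoiAnnealedOneArm` (Tassion 2016, Thm 3 (2): annealed, mesh-uniform polynomial decay of
the black one-arm probability for two independent Poisson processes of Lebesgue intensity).  Route: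
module docstring (defect telescoping in the image domain).  Provable now (lead c3 programme).
(sources: BenjaminiSchramm1998 §4, §9 (9.1); Tassion2016 Thm 3 (2)) -/
def Sig.stub_graphTransportCore : Prop :=
  Literature.Probability.Percolation.VoronoiAnnealedOneArm → Sig.stub_graphTransport

/-- Registered glue sub-goal of this module (existing vocabulary): the graph crossing event is
monotone in the carrier and the attachment sets. -/
theorem graphCross_mono : ∀ (K K' A₀ A₀' A₂ A₂' : Set ℂ) (δ : ℝ), K ⊆ K' → A₀ ⊆ A₀' → A₂ ⊆ A₂' →
    graphCross K A₀ A₂ δ ⊆ graphCross K' A₀' A₂' δ := by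
  intro K K' A₀ A₀' A₂ A₂' δ hK hA₀ hA₂ c hc
  obtain ⟨N, p, hb, hpK, h0, hN, hE⟩ := hc
  exact ⟨N, p, hb, fun i => hK (hpK i), hA₀ h0, hA₂ hN, hE⟩

/-- The empty hybrid is the Euclidean event — with no square
switched, the hybrid chain crossing of the image side is `graphCross` read in the window. -/
theorem adjCross_adjHyb_empty_iff (ℓ : ℝ) (E₁ E₂ : ℂ → ℂ → Prop) (K A₀ A₂ : Set ℂ) (δ : ℝ)
    (b : Set ℂ) : adjCross (adjHyb ∅ ℓ E₁ E₂) K A₀ A₂ δ b ↔ adjCross E₁ K A₀ A₂ δ b := by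
  constructor <;> intro h
  · exact adjCross_mono (fun p q hpq => (adjHyb_empty ℓ E₁ E₂ p q).1 hpq) h
  · exact adjCross_mono (fun p q hpq => (adjHyb_empty ℓ E₁ E₂ p q).2 hpq) h

end Summit.CriticalPhenomena.CardyFormulaZ2.Cruxes.VoronoiHubFromSmirnov.MoebiusExactDelaunayDilationWard

end
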